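import Mathlib
import HarnessLib
import Summits.ValiantsHypothesis.ValiantsHypothesis.Theses.MonotoneRestoration
import Literature.Computability.AlgebraicComplexity.ArithCircuit
import Literature.Computability.AlgebraicComplexity.ArithCircuitProofs
import Literature.Computability.AlgebraicComplexity.MonotoneStructure
import Literature.Computability.AlgebraicComplexity.PermanentIrreducible
import Literature.ModelTheory.FiniteModelTheory.CkEquiv
import Summits.ValiantsHypothesis.ValiantsHypothesis.Theorems.MonotoneRestorationMonotoneRestorationQPCosetCount
import Summits.ValiantsHypothesis.ValiantsHypothesis.Theorems.MonotoneRestorationMonotoneRestorationQPSymmetricLB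
import Summits.ValiantsHypothesis.ValiantsHypothesis.Theorems.MonotoneRestorationMonotoneRestorationQPSupportSymmetrisation
import Summits.ValiantsHypothesis.ValiantsHypothesis.Theorems.MonotoneRestorationMonotoneRestorationQPSparseRegime
import Summits.ValiantsHypothesis.ValiantsHypothesis.Theorems.MonotoneRestorationMonotoneRestorationQPBeta
import Literature.Computability.AlgebraicComplexity.SymmetricArithCircuit
import Literature.Computability.AlgebraicComplexity.DawarWilsenach2025Proofs
import Literature.GroupTheory.PermutationGroups.SmallIndexSubgroups
import Summits.ValiantsHypothesis.ValiantsHypothesis.Theorems.MonotoneRestorationQP.Negative.LoadBearing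
import Summits.ValiantsHypothesis.ValiantsHypothesis.Theorems.MonotoneRestorationMonotoneRestorationQPPermSupportCount

/-! TTRL-lite variant V19885 of stmt-ValiantsHypothesis-15886 (`stub_monotoneComputation_of_complexity`, move `lemma_proposal`) -/

namespace Summit.ValiantsHypothesis.ValiantsHypothesis.Theorems

open Summit.ValiantsHypothesis.ValiantsHypothesis.Theses.MonotoneRestoration
open Literature.Computability.AlgebraicComplexity

/-- TTRL-lite variant V19885 (lemma_proposal) of `stub_monotoneComputation_of_complexity`
(stmt-ValiantsHypothesis-15886): in the weighted-sum gate model, adding a scaled input variable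
costs at most one gate, `L(f + c • X i) ≤ L(f) + 1` — append the single fan-in-two sum gate
`1 • out(P) + c • X i` to a size-optimal fan-in-two circuit `P` of `f`
(Bürgisser 2000, Def. 2.1 / §2.1: weighted sums absorb scalings of their operands). -/
theorem stub_monotoneComputation_of_complexity_var19885 :
    ∀ (σ : Type) (f : MvPolynomial σ NNReal) (c : NNReal) (i : σ),
      complexity (f + c • MvPolynomial.X i) ≤ complexity f + 1 := by
  intro σ f c i
  obtain ⟨P, h2, hf, hs⟩ := ArithCircuit.exists_computes_size_eq_complexity f
  -- the circuit `P` followed by one weighted sum gate `1 • P.output + c • X i`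
  let Q : ArithCircuit NNReal σ :=
    { gates := P.gates ++ [.sum [(1, P.output), (c, .var i)]]
      output := .gate P.size }
  have hQ2 : Q.IsFanInTwo := by
    intro g hg
    simp only [Q, List.mem_append, List.mem_singleton] at hg
    rcases hg with hg | rfl
    · exact h2 g hg
    · simp [ArithCircuit.Gate.fanIn, ArithCircuit.Gate.args]
  have hQe : Q.eval = P.eval + c • MvPolynomial.X i := by
    have h := ArithCircuit.gateValues_length (k := NNReal) P.gates
    simp [Q, ArithCircuit.eval, ArithCircuit.gateValues_append_singleton,
      ArithCircuit.Operand.eval, ArithCircuit.Gate.eval, ArithCircuit.size,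
      List.getD_eq_getElem?_getD, h]
  have hQf : Q.Computes (f + c • MvPolynomial.X i) := by
    rw [ArithCircuit.Computes] at hf ⊢
    rw [hQe, hf]
  have hQs : Q.size = P.size + 1 := by
    simp [Q, ArithCircuit.size]
  calc complexity (f + c • MvPolynomial.X i) ≤ Q.size := ArithCircuit.complexity_le_size hQ2 hQf
    _ = complexity f + 1 := by rw [hQs, hs]

end Summit.ValiantsHypothesis.ValiantsHypothesis.Theorems
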